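import Literature.NumberTheory.LFunctions.DeBruijnNewmanUpperBoundProofs
import Literature.NumberTheory.LFunctions.DeBruijnNewmanTable1Rectangles
import Literature.NumberTheory.DiophantineGeometry.NamedHypotheses
import HarnessLib

/-!
# Polymath 15, Theorem 1.1 (`Λ ≤ 0.22`) assembled from its printed inputs

Trunk T-ANT (`Literature/NumberTheory/LFunctions`); companion of `DeBruijnNewmanUpperBound.lean`,
which vendors Polymath 15, Thm. 1.1 as the named fact
`Literature.NumberTheory.LFunctions.Polymath15.new_upper_bound` (`∀ t > 0.22`, `H_t` has only real
zeros), and of `DeBruijnNewmanUpperBoundProofs.lean`, where the analytic part of its proof — the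
upper bound criterion, Polymath 15, Thm. 1.2 — is PROVED
(`Literature.NumberTheory.LFunctions.Polymath15.upper_bound_criterion_holds`).

## What the printed proof of Thm. 1.1 consists of (Polymath 15, §1 and §8)

"We will obtain Theorem 1.1 by applying Theorem 1.2 with the specific numerical choices `t₀ = 0.2`,
`X = 6 × 10¹⁰ + 83952 − 0.5`, and `y₀ = 0.2`" (§1, after Thm. 1.2; §8.1: `X := X₀ − 0.5`,
`X₀ := 6 × 10¹⁰ + 83952`), so that `Λ ≤ t₀ + y₀²/2 = 0.22`. Of the three hypotheses of Thm. 1.2: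

* (i) "is immediate from the result of Platt [Math. Comp. 86 (2017)] that all the non-trivial
  zeroes of `ζ` with imaginary part between `0` and `3.06 × 10¹⁰` lie on the critical line" (§8.2)
  — a certified computation (note `X/2 = 3·10¹⁰ + 41975.75 ≤ 3.06·10¹⁰`);
* (ii), (iii): "it will suffice to verify that `H_t(x+iy) ≠ 0`" in the regions (ii) `x ≥ X₀ − 0.5 +
  √0.96`, `0.2 ≤ y ≤ √0.6`, `t = 0.2` and (iii) `X₀ − 0.5 ≤ x ≤ X₀ + 0.5`, `0.2 ≤ y ≤ √0.6`,
  `0 ≤ t ≤ 0.2` ("Here we have enlarged the region (iii) for simplicity"), which §8.2 covers by the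
  three regions (a) `X₀ − 0.5 ≤ x ≤ X₀ + 0.5`, `0 ≤ t ≤ 0.2`, `0.2 ≤ y ≤ 1` (`N = N₀ = 69098`),
  (b) `x ≥ X₀ − 0.5`, `N₀ ≤ N ≤ N₁ = 1.5·10⁶`, `t = 0.2`, `0.2 ≤ y ≤ 1`, (c) `N ≥ N₁`, `t = 0.2`,
  `0.2 ≤ y ≤ 1`; all three are settled through Prop. 8.1 (`H_t/B_t = f_t + O_≤(1.25·10⁻³)`, from the
  effective approximation Thm. 1.3, the named fact
  `Literature.NumberTheory.LFunctions.Polymath15.effective_approximation`) by, respectively, a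
  Rouché/winding-number mesh computation (§8.4), an Euler-mollified argument-principle mesh
  computation (§8.5), and the bound `f_t = 1 + O_≤(0.955)` with numerically evaluated sums (§8.3) —
  certified computations again.

Accordingly `new_upper_bound` is not discharged in the tree (its computational inputs are outside
kernel evaluation). This file records, with kernel-checked arithmetic, exactly what those
computations have to deliver:

* `Polymath15.new_upper_bound_of_rectangles` (PROVED): Thm. 1.1 from (i) = RH up to height
  `3.06·10¹⁰` (Platt 2017 as quoted in §8.2, in the form of the hypothesis
  `RiemannHypothesisUpTo (3.06·10¹⁰)` of
  `Literature/NumberTheory/DiophantineGeometry/NamedHypotheses.lean`) and the non-vanishing of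
  `H_t` on the two rectangles (a) and (b) ∪ (c) of §8.2, via
  `upper_bound_criterion_holds` at the printed parameters and
  `Polymath15.final_and_barrier_of_rectangles` (`DeBruijnNewmanTable1Rectangles.lean`);
* `Polymath15.new_upper_bound_of_numerics` (PROVED): Thm. 1.1 from the two computational named
  facts already in the tree, `Literature.NumberTheory.LFunctions.platt_trudgian_numerical_rh`
  (RH to height `3 000 175 332 800`, Platt–Trudgian 2021, Thm. 1) and
  `Literature.NumberTheory.LFunctions.Polymath15.table1_row2` (Polymath 15, §10, Table 1, row 2),
  through `platt_trudgian_of_numerics` (`Λ ≤ 0.2`, Platt–Trudgian 2021, Cor. 2) and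
  `Polymath15.new_upper_bound_of_platt_trudgian`. These two facts are the trust base of
  `new_upper_bound` in the tree.

No named facts are introduced here: the inputs of Thm. 1.1 that are computations appear only as
hypotheses of proved theorems.

## References

* D. H. J. Polymath, *Effective approximation of heat flow evolution of the Riemann `ξ` function,
  and a new upper bound for the de Bruijn–Newman constant*, Res. Math. Sci. 6 (2019), Paper 31
  (arXiv:1904.12438): Thm. 1.1, Thm. 1.2, §8.1 (parameters), §8.2 (claims (i)–(iii), regions
  (a)–(c), Prop. 8.1), §8.3–8.5.
* D. J. Platt, *Isolating some non-trivial zeros of zeta*, Math. Comp. 86 (2017) 2449–2467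
  (RH for `0 < Im s ≤ 3.06·10¹⁰`, as cited in Polymath 15, §8.2).
* D. J. Platt, T. S. Trudgian, *The Riemann hypothesis is true up to `3·10¹²`*, Bull. Lond. Math.
  Soc. 53 (2021) 792–797, Thm. 1, §3.4, Cor. 2.
-/

noncomputable section

open Complex

namespace Literature.NumberTheory.LFunctions

namespace Polymath15

/-- **Polymath 15, Thm. 1.1 (`Λ ≤ 0.22`) from its printed inputs** (§8.1–8.2). Let
`X = 6·10¹⁰ + 83952 − 0.5` (`= X₀ − 0.5`). Assume (i) RH up to height `3.06·10¹⁰`: every zero `s`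
of `ζ` with `0 < Im s ≤ 3.06·10¹⁰` has `Re s = 1/2` (the result of Platt, Math. Comp. 86 (2017), as
quoted in §8.2); (b) ∪ (c) `H_{0.2}(x + iy) ≠ 0` for `x ≥ X`, `0.2 ≤ y ≤ 1`; (a) `H_t(x + iy) ≠ 0`
for `0 ≤ t ≤ 0.2`, `X ≤ x ≤ X + 1`, `0.2 ≤ y ≤ 1`. Then `H_t` has only real zeros for every
`t > 0.22`.
Proof as printed: the two rectangles contain the regions (ii), (iii) of Thm. 1.2
(`final_and_barrier_of_rectangles`); (i) gives hypothesis (i) of Thm. 1.2 because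
`X/2 = 3·10¹⁰ + 41975.75 ≤ 3.06·10¹⁰` and `ζ` has no real zeros in `[0.6, 1]`
(`initialZeroFree_of_numerical_rh`); and Thm. 1.2 (`upper_bound_criterion_holds`) with
`t₀ = y₀ = 0.2` gives real zeros for `t > 0.2 + 0.2²/2 = 0.22`.
[cite: Polymath2019, Thm. 1.1 and §8.1–8.2] -/
theorem new_upper_bound_of_rectangles
    (hRH : DiophantineGeometry.RiemannHypothesisUpTo (3.06 * 10 ^ 10))
    (hbc : ∀ x y : ℝ, (6 * 10 ^ 10 + 83952 - 0.5 : ℝ) ≤ x → (0.2 : ℝ) ≤ y → y ≤ 1 →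
      deBruijnH 0.2 (x + y * I) ≠ 0)
    (ha : ∀ t x y : ℝ, 0 ≤ t → t ≤ 0.2 → (6 * 10 ^ 10 + 83952 - 0.5 : ℝ) ≤ x →
      x ≤ 6 * 10 ^ 10 + 83952 - 0.5 + 1 → (0.2 : ℝ) ≤ y → y ≤ 1 → deBruijnH t (x + y * I) ≠ 0) :
    new_upper_bound := by
  intro t ht
  obtain ⟨hii, hiii⟩ := final_and_barrier_of_rectangles (by norm_num) (by norm_num) hbc ha
  refine upper_bound_criterion_holds 0.2 (6 * 10 ^ 10 + 83952 - 0.5) 0.2 (by norm_num) (by norm_num)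
    (by norm_num) (by norm_num)
    (initialZeroFree_of_numerical_rh (H := 3.06 * 10 ^ 10) (by norm_num) (by norm_num)
      fun s hs h0 hT ↦ hRH s hs h0 hT)
    hii hiii t ?_
  have h22 : (0.2 : ℝ) + 0.2 ^ 2 / 2 = 0.22 := by norm_num
  rw [h22]
  exact ht

/-- **Polymath 15, Thm. 1.1 from the two computational named facts of the tree.** RH up to height
`3 000 175 332 800` (`platt_trudgian_numerical_rh`, Platt–Trudgian 2021, Thm. 1) and Polymath 15,
§10, Table 1, row 2 (`table1_row2`) give `Λ ≤ 0.2` (`platt_trudgian_of_numerics`, Platt–Trudgian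
2021, Cor. 2, with Thm. 1.2 proved), hence `Λ ≤ 0.22` (`new_upper_bound_of_platt_trudgian`).
[cite: PlattTrudgianBLMS2021, Cor. 2] -/
theorem new_upper_bound_of_numerics (h₁ : LFunctions.platt_trudgian_numerical_rh)
    (h₃ : table1_row2) : new_upper_bound :=
  new_upper_bound_of_platt_trudgian (platt_trudgian_of_numerics h₁ h₃)

end Polymath15

end Literature.NumberTheory.LFunctions

end
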